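import Literature.Probability.LatticeModels.FKInterfaceDrivingLocality
import HarnessLib

/-!
# Capacity clocks, lattice steps: one exploration step adds little capacity

Crux `…CardyUniqueLimit.CardyRigidity` (stmt-CriticalPhenomena-0746), line `crossing_martingale`,
stub A3a.  Deterministic facts about ONE configuration `ω` whose exploration polyline
`P = polyline (γ_0 … γ_N)` is described through a chordal uniformizing map `φ'` of `(D'; a', b')`
by `W` (`Φ = φ'.boundaryExtension`, `γ̂ = Loewner.trace W`), with prefix traces
`S_n = range (polyline (γ_0 … γ_{n+1}))` and capacity times `T_n`, `Φ(γ̂[0, T_n]) = S_n`: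
`S_{n+1} ⊆ S_n ∪ [γ_{n+1}, γ_{n+2}]`; consecutive medial points are `2δ`-close; `b'` lies on the
full trace, on no `Φ(γ̂[0, T])`, and an initial segment of `P` containing `b'` is the whole
trace; and **`exists_capTime_zero` / `exists_capTime_succ`**: given a window `Δ` of uniform
non-stalling (`ρ`), almost-injectivity of `Φ` at scale `m` and properness `ρ₁` on the half-disc
of radius `R ⊇ γ̂[0, L + Δ]`, and `4δ < m`, `2δ < ρ₁`: `T_0 ≤ Δ` exists, and `T_n ≤ L` implies
that `T_{n+1}` exists with `T_{n+1} ≤ T_n + Δ`.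
-/

noncomputable section

open Filter Set Topology Metric
open scoped NNReal unitInterval
open UpperHalfPlane (upperHalfPlaneSet)
open Literature.Probability Literature.Probability.RandomPlanarGeometry
  Literature.Probability.LatticeModels Literature.Probability.LatticeModels.DiscreteDobrushin

namespace Summit.CriticalPhenomena.CardyFormulaZ2.Cruxes.CardyRigidity.CrossingMartingale

namespace CapacityClock

/-! ### Polylines: the last segment -/

/-- **Appending a vertex adds one segment**: the trace of `polyline (l ++ [x])` is contained in
the trace of `polyline l` together with the segment from the last vertex of `l` to `x`.
[cite: CamiaNewman2007, §2] -/
theorem range_polyline_concat_subset {X : Type*} [AddCommGroup X] [Module ℝ X]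
    [TopologicalSpace X] [ContinuousAdd X] [ContinuousSMul ℝ X] {l : List X} (hl : l ≠ [])
    (x : X) : range (polyline (l ++ [x])) ⊆ range (polyline l) ∪ segment ℝ (l.getLast hl) x := by
  obtain ⟨a, m, rfl⟩ := List.exists_cons_of_ne_nil hl
  suffices h : ∀ (a : X) (m : List X), range (polylineFrom a (m ++ [x])).2 ⊆
      range (polylineFrom a m).2 ∪ segment ℝ ((a :: m).getLast (List.cons_ne_nil a m)) x by
    exact h a m
  intro a m
  induction m generalizing a with
  | nil =>
    change range ((Path.segment a x).trans (Path.refl x)) ⊆ range (Path.refl a) ∪ segment ℝ a x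
    rw [Path.trans_range, Path.range_segment, Path.refl_range, Path.refl_range]
    rintro y (hy | hy)
    · exact Or.inr hy
    · rw [mem_singleton_iff] at hy
      exact Or.inr (hy ▸ right_mem_segment ℝ a x)
  | cons b m ih =>
    rw [List.cons_append, polylineFrom_cons, polylineFrom_cons]
    change range ((Path.segment a b).trans (polylineFrom b (m ++ [x])).2) ⊆
      range ((Path.segment a b).trans (polylineFrom b m).2) ∪ _
    rw [Path.trans_range, Path.trans_range, List.getLast_cons (List.cons_ne_nil b m)]
    rintro y (hy | hy)
    · exact Or.inl (Or.inl hy)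
    · rcases ih b hy with h | h
      · exact Or.inl (Or.inr h)
      · exact Or.inr h

variable {E : DiscreteDobrushin} {ω : Percolation.BondConfig (Site 2)}

/-- **One more exploration step adds one segment**: `S_{n+1} ⊆ S_n ∪ [γ_{n+1}, γ_{n+2}]` and
`γ_{n+1} ∈ S_n` (interfaces with more than `n + 2` vertices). [cite: DuminilCopinSmirnov2012Clay, §6.2, Lemma 6.6] -/
theorem range_prefix_succ_subset {n : ℕ} (hn : n + 2 < (medialExploration E ω).length) :
    range (polyline ((explorationPrefix E (n + 1) ω).map (medialPoint E.δ))) ⊆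
      range (polyline ((explorationPrefix E n ω).map (medialPoint E.δ))) ∪
        segment ℝ (medialPoint E.δ (medialExploration E ω)[n + 1])
          (medialPoint E.δ (medialExploration E ω)[n + 2]) ∧
    medialPoint E.δ (medialExploration E ω)[n + 1] ∈
      range (polyline ((explorationPrefix E n ω).map (medialPoint E.δ))) := by
  have htake : explorationPrefix E (n + 1) ω =
      explorationPrefix E n ω ++ [(medialExploration E ω)[n + 2]] := by
    unfold explorationPrefix
    exact List.take_succ_eq_append_getElem hn
  have hne : (explorationPrefix E n ω).map (medialPoint E.δ) ≠ [] := by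
    unfold explorationPrefix
    intro h
    rw [List.map_eq_nil_iff, List.take_eq_nil_iff] at h
    rcases h with h | h
    · omega
    · rw [h] at hn; simp at hn
  have hlast : ((explorationPrefix E n ω).map (medialPoint E.δ)).getLast hne =
      medialPoint E.δ (medialExploration E ω)[n + 1] := by
    rw [List.getLast_map, List.getLast_eq_getElem]
    congr 1
    unfold explorationPrefix
    rw [List.getElem_take]
    congr 1
    rw [List.length_take]
    omega
  refine ⟨?_, ?_⟩
  · rw [htake, List.map_append, List.map_singleton, ← hlast]
    exact range_polyline_concat_subset hne _
  · rw [← hlast]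
    exact mem_range_polyline (List.getLast_mem hne)

/-- **Consecutive medial points of the exploration are `2δ`-close.** [cite: Smirnov2001, §2] -/
theorem dist_medialPoint_getElem_succ_le (hexp : IsMedialExploration E ω (medialExploration E ω))
    (hδ : 0 ≤ E.δ) {i : ℕ} (hi : i + 1 < (medialExploration E ω).length) :
    dist (medialPoint E.δ (medialExploration E ω)[i])
      (medialPoint E.δ (medialExploration E ω)[i + 1]) ≤ 2 * E.δ := by
  have hinf : [(medialExploration E ω)[i], (medialExploration E ω)[i + 1]] <:+:
      medialExploration E ω := by
    refine ⟨(medialExploration E ω).take i, (medialExploration E ω).drop (i + 2), ?_⟩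
    conv_rhs => rw [← List.take_append_drop i (medialExploration E ω)]
    rw [List.drop_eq_getElem_cons (show i < (medialExploration E ω).length by omega),
      List.drop_eq_getElem_cons hi]
    simp
  obtain ⟨v, f, hvf, -, hs, ht⟩ := hexp.step _ _ hinf
  rw [← hs, ← ht]
  have h1 := dist_medialPoint_cornerSource_le hδ hvf
  have h2 := dist_medialPoint_cornerTarget_le hδ hvf
  rw [dist_comm] at h2
  linarith [dist_triangle (medialPoint E.δ (cornerSource v f)) (meshPoint E.δ v)
    (medialPoint E.δ (cornerTarget v f))]

/-! ### Described polylines: the target point and initial segments -/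

variable {D' : DobrushinDomain} {φ' : ConformalEquiv upperHalfPlaneSet D'.carrier}
  {W : ℝ≥0 → ℝ} {P : C(I, ℂ)}

/-- The trace of a described polyline is that of the compactified image curve. [cite: Lawler2005, §4.1] -/
theorem range_eq_of_eq_mk {c' : Curve ℂ} (hc' : CurveClass.mk ⟨P⟩ = CurveClass.mk c') :
    range P = range (c' : I → ℂ) := by
  have h := congrArg CurveClass.range hc'
  rw [CurveClass.range_mk, CurveClass.range_mk] at h
  exact h

/-- **The target point lies on the trace of a described polyline** (`c' 1 = b'`).
[cite: Lawler2005, §6.3] -/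
theorem pt_one_mem_range (hdesc : IsLoewnerDescribed φ' (CurveClass.mk ⟨P⟩) W) :
    D'.pt 1 ∈ range P := by
  obtain ⟨-, c', hc', hI⟩ := hdesc.exists_eq_mk_trace
  rw [range_eq_of_eq_mk hc', ← hI.2]
  exact mem_range_self _

/-- **No capacity time covers the whole trace**: `Φ(γ̂[0, T]) ∌ b'` is never `range P`.
[cite: PommerenkeBBCM1992, Thm. 2.6] -/
theorem image_trace_ne_range (hφ' : D'.IsChordalUniformizing φ')
    (hdesc : IsLoewnerDescribed φ' (CurveClass.mk ⟨P⟩) W) (T : ℝ≥0) :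
    φ'.boundaryExtension '' (Loewner.trace W '' Icc 0 T) ≠ range P := by
  intro h
  have hb := pt_one_mem_range hdesc
  rw [← h] at hb
  obtain ⟨_, ⟨u, -, rfl⟩, hu⟩ := hb
  exact MarkedDomain.boundaryExtension_ne_pt_one JordanDomain.exists_continuousOn_extension_holds
    hφ' (hdesc.exists_eq_mk_trace.1.im_nonneg u) hu

/-- **An initial segment of the polyline containing `b'` is the whole trace.** [cite: Lawler2005, §6.3] -/
theorem image_Iic_eq_range_of_pt_one_mem (hφ' : D'.IsChordalUniformizing φ')
    (hdesc : IsLoewnerDescribed φ' (CurveClass.mk ⟨P⟩) W) {r : I}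
    (hb : D'.pt 1 ∈ P '' Iic r) : P '' Iic r = range P := by
  obtain ⟨hgen, c', hc', hI⟩ := hdesc.exists_eq_mk_trace
  have hdist : dist (⟨P⟩ : Curve ℂ) c' = 0 := CurveClass.mk_eq_mk_iff_dist_eq_zero.1 hc'
  obtain ⟨s₂, hs₂⟩ := Curve.exists_image_Iic_eq_of_dist_eq_zero hdist r
  have hs₂' : (P : I → ℂ) '' Iic r = (c' : I → ℂ) '' Iic s₂ := hs₂
  have hb' : D'.pt 1 ∈ (c' : I → ℂ) '' Iic s₂ := hs₂' ▸ hb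
  obtain ⟨s, hs, hsb⟩ := hb'
  have hs1 : (s : ℝ) = 1 := by
    by_contra hne
    have hlt : (s : ℝ) < 1 := lt_of_le_of_ne s.2.2 hne
    rw [hI.1 s hlt] at hsb
    exact MarkedDomain.boundaryExtension_ne_pt_one
      JordanDomain.exists_continuousOn_extension_holds hφ' (hgen.im_nonneg _) hsb
  have hs₂1 : s₂ = 1 := by
    apply Subtype.ext
    apply le_antisymm s₂.2.2
    have : (s : ℝ) ≤ s₂ := Subtype.coe_le_coe.2 hs
    change (1 : ℝ) ≤ s₂
    linarith
  refine Subset.antisymm (image_subset_range _ _) ?_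
  rw [range_eq_of_eq_mk hc', hs₂', hs₂1]
  rintro _ ⟨t, rfl⟩
  exact ⟨t, t.2.2, rfl⟩

/-- **The polyline starts at `Φ(γ̂ 0)`** (sources of equal classes agree). [cite: Lawler2005, §4.1] -/
theorem apply_zero_eq (hdesc : IsLoewnerDescribed φ' (CurveClass.mk ⟨P⟩) W) :
    P 0 = φ'.boundaryExtension (Loewner.trace W 0) := by
  obtain ⟨-, c', hc', hI⟩ := hdesc.exists_eq_mk_trace
  have h := congrArg CurveClass.source hc'
  rw [CurveClass.source_mk, CurveClass.source_mk, Curve.source_def, Curve.source_def] at h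
  change P 0 = c' 0 at h
  rw [h, hI.1 0 (by norm_num), rayParam_zero]

/-- **Trace segments up to an initial segment of the polyline**: if every capacity time `T` of
`P[0, r]` (if any) satisfies `u ≤ T`, then `Φ(γ̂[0, u]) ⊆ P[0, r]` (a capacity time exists, or
`b' ∈ P[0, r]`, which is then the whole trace). [cite: DuminilCopinSmirnov2012Clay, Prop. 6.7 (proof, p. 29)] -/
theorem image_trace_subset_image_Iic (hφ' : D'.IsChordalUniformizing φ')
    (hdesc : IsLoewnerDescribed φ' (CurveClass.mk ⟨P⟩) W) {r : I} {u : ℝ≥0}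
    (h : ∀ T : ℝ≥0, φ'.boundaryExtension '' (Loewner.trace W '' Icc 0 T) = P '' Iic r → u ≤ T) :
    φ'.boundaryExtension '' (Loewner.trace W '' Icc 0 u) ⊆ P '' Iic r := by
  by_cases hb : D'.pt 1 ∈ P '' Iic r
  · rw [image_Iic_eq_range_of_pt_one_mem hφ' hdesc hb]
    obtain ⟨-, c', hc', hI⟩ := hdesc.exists_eq_mk_trace
    obtain ⟨s, hs1, hsu⟩ := exists_rayParam_eq u
    rw [range_eq_of_eq_mk hc', ← hsu, ← hI.image_Iic_eq hs1]
    exact image_subset_range _ _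
  · obtain ⟨T, hT⟩ := hdesc.exists_image_trace_eq hφ' (r := r) hb
    have hT' : φ'.boundaryExtension '' (Loewner.trace W '' Icc 0 T) = P '' Iic r := hT
    rw [← hT']
    exact image_mono (image_mono (Icc_subset_Icc_right (h T hT')))

/-! ### Capacity times of the exploration prefixes: existence and small increments -/

/-- **The first capacity time exists and is small**: with two `ρ`-apart points of `γ̂[0, Δ]`, a
radius `R` bounding `γ̂[0, Δ]`, almost-injectivity `m` and properness `ρ₁` of `Φ` there, and
`4δ < m`, `2δ < ρ₁`, the capacity time `T_0` of `[γ_0, γ_1] ∌ b'` exists and `T_0 ≤ Δ`.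
[cite: KemppainenSmirnov2017, §3.5] -/
theorem exists_capTime_zero (hφ' : D'.IsChordalUniformizing φ')
    (hdesc : IsLoewnerDescribed φ'
      (CurveClass.mk ⟨polyline ((medialExploration E ω).map (medialPoint E.δ))⟩) W)
    (hexp : IsMedialExploration E ω (medialExploration E ω)) (hδ : 0 ≤ E.δ)
    {R ρ m ρ₁ : ℝ} {Δ : ℝ≥0}
    (hbound : ∀ u ≤ Δ, ‖Loewner.trace W u‖ ≤ R)
    (hNS : ∃ s ∈ Icc 0 Δ, ∃ s' ∈ Icc 0 Δ, ρ ≤ dist (Loewner.trace W s) (Loewner.trace W s'))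
    (hAI : ∀ z w : ℂ, 0 ≤ z.im → ‖z‖ ≤ R → 0 ≤ w.im → ‖w‖ ≤ R →
      dist (φ'.boundaryExtension z) (φ'.boundaryExtension w) < m → dist z w < ρ)
    (hproper : ∀ z : ℂ, 0 ≤ z.im → ‖z‖ ≤ R → ρ₁ ≤ dist (φ'.boundaryExtension z) (D'.pt 1))
    (hδm : 4 * E.δ < m) (hδρ : 2 * E.δ < ρ₁) :
    ∃ T₀ : ℝ≥0, φ'.boundaryExtension '' (Loewner.trace W '' Icc 0 T₀) =
        range (polyline ((explorationPrefix E 0 ω).map (medialPoint E.δ))) ∧ T₀ ≤ Δ := by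
  set Φ := φ'.boundaryExtension with hΦ
  set γ := Loewner.trace W with hγ
  have hgen : Loewner.IsGeneratedByCurve W γ := hdesc.exists_eq_mk_trace.1
  -- the first two vertices
  obtain ⟨a, l₁, hal⟩ := List.exists_cons_of_ne_nil hexp.ne_nil
  obtain ⟨b, l₂, hbl⟩ : ∃ b l₂, l₁ = b :: l₂ := by
    cases hq : l₁ with
    | nil =>
      exfalso
      have h := hexp.head_ne_getLast
      simp [hal, hq] at h
    | cons b l₂ => exact ⟨b, l₂, rfl⟩
  subst hbl
  have hpre : explorationPrefix E 0 ω = [a, b] := by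
    unfold explorationPrefix
    rw [hal]
    rfl
  have hS0 : range (polyline ((explorationPrefix E 0 ω).map (medialPoint E.δ))) ⊆
      closedBall (medialPoint E.δ a) (2 * E.δ) := by
    rw [hpre, List.map_cons, List.map_singleton]
    change range ((Path.segment (medialPoint E.δ a) (medialPoint E.δ b)).trans
      (polylineFrom (medialPoint E.δ b) []).2) ⊆ _
    rw [polylineFrom_nil, Path.trans_range, Path.range_segment, Path.refl_range]
    have hab : dist (medialPoint E.δ a) (medialPoint E.δ b) ≤ 2 * E.δ := by
      have h01 : 0 + 1 < (medialExploration E ω).length := by rw [hal]; simp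
      have := dist_medialPoint_getElem_succ_le hexp hδ h01
      simpa [hal] using this
    have hbmem : medialPoint E.δ b ∈ closedBall (medialPoint E.δ a) (2 * E.δ) :=
      mem_closedBall'.2 hab
    exact union_subset ((convex_closedBall _ _).segment_subset (mem_closedBall_self (by positivity))
      hbmem) (singleton_subset_iff.2 hbmem)
  -- the polyline starts at `Φ (γ 0)`
  have hstart : medialPoint E.δ a = Φ (γ 0) := by
    have := apply_zero_eq hdesc
    rwa [hal, List.map_cons, polyline_apply_zero] at this
  have hρ₁ : ρ₁ ≤ dist (Φ (γ 0)) (D'.pt 1) := hproper _ (hgen.im_nonneg 0) (hbound 0 zero_le)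
  -- `b'` is off the first segment
  have hb : D'.pt 1 ∉ range (polyline ((explorationPrefix E 0 ω).map (medialPoint E.δ))) := by
    intro h
    have h1 : dist (D'.pt 1) (Φ (γ 0)) ≤ 2 * E.δ := by rw [← hstart]; exact mem_closedBall.1 (hS0 h)
    rw [dist_comm] at h1
    linarith
  have hb' : D'.pt 1 ∉ ((⟨polyline ((medialExploration E ω).map (medialPoint E.δ))⟩ : Curve ℂ) :
      I → ℂ) '' Iic ⟨1 - (1 / 2) ^ (0 + 1), one_sub_half_pow_mem_unitInterval _⟩ := by
    change D'.pt 1 ∉ polyline ((medialExploration E ω).map (medialPoint E.δ)) '' _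
    rwa [image_Iic_polyline_map_eq_range_prefix]
  obtain ⟨T₀, hT₀⟩ := hdesc.exists_image_trace_eq hφ' hb'
  have hT₀' : Φ '' (γ '' Icc 0 T₀) = range (polyline ((explorationPrefix E 0 ω).map (medialPoint E.δ))) := by
    have := hT₀
    change Φ '' (γ '' Icc 0 T₀) = polyline ((medialExploration E ω).map (medialPoint E.δ)) '' _ at this
    rwa [image_Iic_polyline_map_eq_range_prefix] at this
  refine ⟨T₀, hT₀', ?_⟩
  by_contra hgt
  push Not at hgt
  obtain ⟨s, hs, s', hs', hfar⟩ := hNS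
  have key : ∀ {r : ℝ≥0}, r ∈ Icc 0 Δ → dist (Φ (γ r)) (Φ (γ 0)) ≤ 2 * E.δ := by
    intro r hr
    have h1 : Φ (γ r) ∈ range (polyline ((explorationPrefix E 0 ω).map (medialPoint E.δ))) := by
      rw [← hT₀']
      exact mem_image_of_mem Φ (mem_image_of_mem γ ⟨zero_le, hr.2.trans hgt.le⟩)
    rw [← hstart]
    exact mem_closedBall.1 (hS0 h1)
  have hds : dist (Φ (γ s)) (Φ (γ s')) < m := by
    linarith [dist_triangle_right (Φ (γ s)) (Φ (γ s')) (Φ (γ 0)), key hs, key hs']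
  have := hAI (γ s) (γ s') (hgen.im_nonneg s) (hbound s hs.2) (hgen.im_nonneg s') (hbound s' hs'.2) hds
  linarith

/-- **One exploration step adds at most `Δ` of capacity time, before the horizon**: with
uniform non-stalling `ρ` in windows `[T, T + Δ]`, `T ≤ L`, a radius `R` bounding `γ̂[0, L + Δ]`,
almost-injectivity `m` and properness `ρ₁` of `Φ` there, `4δ < m`, `2δ < ρ₁`: if `T_n ≤ L` then
`T_{n+1}` exists and `T_{n+1} ≤ T_n + Δ` (new points of `γ̂` after `T_n` are mapped into the new
segment, of length `≤ 2δ`, and two of them in the window are `ρ`-apart). [cite: KemppainenSmirnov2017, §3.5] -/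
theorem exists_capTime_succ (hφ' : D'.IsChordalUniformizing φ')
    (hdesc : IsLoewnerDescribed φ'
      (CurveClass.mk ⟨polyline ((medialExploration E ω).map (medialPoint E.δ))⟩) W)
    (hexp : IsMedialExploration E ω (medialExploration E ω)) (hδ : 0 ≤ E.δ)
    {R ρ m ρ₁ : ℝ} {L Δ : ℝ≥0}
    (hbound : ∀ u ≤ L + Δ, ‖Loewner.trace W u‖ ≤ R)
    (hNS : ∀ T ≤ L, ∃ s ∈ Icc T (T + Δ), ∃ s' ∈ Icc T (T + Δ),
      Loewner.trace W s ∉ Loewner.trace W '' Icc 0 T ∧ Loewner.trace W s' ∉ Loewner.trace W '' Icc 0 T ∧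
      ρ ≤ dist (Loewner.trace W s) (Loewner.trace W s'))
    (hAI : ∀ z w : ℂ, 0 ≤ z.im → ‖z‖ ≤ R → 0 ≤ w.im → ‖w‖ ≤ R →
      dist (φ'.boundaryExtension z) (φ'.boundaryExtension w) < m → dist z w < ρ)
    (hproper : ∀ z : ℂ, 0 ≤ z.im → ‖z‖ ≤ R → ρ₁ ≤ dist (φ'.boundaryExtension z) (D'.pt 1))
    (hδm : 4 * E.δ < m) (hδρ : 2 * E.δ < ρ₁)
    {n : ℕ} {Tn : ℝ≥0} (hTn : Tn ≤ L)
    (hcap : φ'.boundaryExtension '' (Loewner.trace W '' Icc 0 Tn) =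
      range (polyline ((explorationPrefix E n ω).map (medialPoint E.δ)))) :
    ∃ T' : ℝ≥0, φ'.boundaryExtension '' (Loewner.trace W '' Icc 0 T') =
        range (polyline ((explorationPrefix E (n + 1) ω).map (medialPoint E.δ))) ∧ T' ≤ Tn + Δ := by
  set Φ := φ'.boundaryExtension with hΦ
  set γ := Loewner.trace W with hγ
  have hgen : Loewner.IsGeneratedByCurve W γ := hdesc.exists_eq_mk_trace.1
  by_cases hlen : (medialExploration E ω).length ≤ n + 2
  · have heq : explorationPrefix E (n + 1) ω = explorationPrefix E n ω := by
      unfold explorationPrefix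
      rw [List.take_of_length_le (by omega), List.take_of_length_le hlen]
    exact ⟨Tn, by rw [heq, hcap], le_self_add⟩
  push Not at hlen
  obtain ⟨hsub, hvert⟩ := range_prefix_succ_subset (E := E) (ω := ω) hlen
  have hstep := dist_medialPoint_getElem_succ_le hexp hδ hlen
  set x₁ := medialPoint E.δ (medialExploration E ω)[n + 1] with hx₁
  set x₂ := medialPoint E.δ (medialExploration E ω)[n + 2] with hx₂
  have hsegball : segment ℝ x₁ x₂ ⊆ closedBall x₁ (2 * E.δ) :=
    (convex_closedBall _ _).segment_subset (mem_closedBall_self (by positivity))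
      (mem_closedBall'.2 hstep)
  -- the old trace is far from `b'`
  have hfarS : ∀ x ∈ range (polyline ((explorationPrefix E n ω).map (medialPoint E.δ))),
      ρ₁ ≤ dist x (D'.pt 1) := by
    intro x hx
    rw [← hcap] at hx
    obtain ⟨_, ⟨u, hu, rfl⟩, rfl⟩ := hx
    exact hproper _ (hgen.im_nonneg u) (hbound u (hu.2.trans (hTn.trans le_self_add)))
  have hρ₁ : 0 < ρ₁ := by nlinarith
  -- `b'` is off the new prefix trace
  have hb : D'.pt 1 ∉ range (polyline ((explorationPrefix E (n + 1) ω).map (medialPoint E.δ))) := by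
    intro hbS
    rcases hsub hbS with h | h
    · have := hfarS _ h
      rw [dist_self] at this
      linarith
    · have h1 : dist (D'.pt 1) x₁ ≤ 2 * E.δ := mem_closedBall.1 (hsegball h)
      have h2 := hfarS _ hvert
      rw [dist_comm] at h1
      linarith
  have hb' : D'.pt 1 ∉ ((⟨polyline ((medialExploration E ω).map (medialPoint E.δ))⟩ : Curve ℂ) :
      I → ℂ) '' Iic ⟨1 - (1 / 2) ^ (n + 1 + 1), one_sub_half_pow_mem_unitInterval _⟩ := by
    change D'.pt 1 ∉ polyline ((medialExploration E ω).map (medialPoint E.δ)) '' _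
    rwa [image_Iic_polyline_map_eq_range_prefix]
  obtain ⟨T', hT'⟩ := hdesc.exists_image_trace_eq hφ' hb'
  have hT'' : Φ '' (γ '' Icc 0 T') =
      range (polyline ((explorationPrefix E (n + 1) ω).map (medialPoint E.δ))) := by
    have := hT'
    change Φ '' (γ '' Icc 0 T') = polyline ((medialExploration E ω).map (medialPoint E.δ)) '' _ at this
    rwa [image_Iic_polyline_map_eq_range_prefix] at this
  refine ⟨T', hT'', ?_⟩
  by_contra hgt
  push Not at hgt
  obtain ⟨s, hs, s', hs', hnew, hnew', hfar⟩ := hNS Tn hTn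
  -- new points in the window are mapped into the new segment
  have key : ∀ {r : ℝ≥0}, r ∈ Icc Tn (Tn + Δ) → γ r ∉ γ '' Icc 0 Tn → Φ (γ r) ∈ segment ℝ x₁ x₂ := by
    intro r hr hnewr
    have h1 : Φ (γ r) ∈ range (polyline ((explorationPrefix E (n + 1) ω).map (medialPoint E.δ))) := by
      rw [← hT'']
      exact mem_image_of_mem Φ (mem_image_of_mem γ ⟨zero_le, hr.2.trans hgt.le⟩)
    rcases hsub h1 with h | h
    · exfalso
      rw [← hcap] at h
      obtain ⟨_, ⟨u, hu, rfl⟩, hzu⟩ := h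
      have := JordanDomain.injOn_boundaryExtension φ' (hgen.im_nonneg u) (hgen.im_nonneg r) hzu
      exact hnewr ⟨u, hu, this⟩
    · exact h
  have hds : dist (Φ (γ s)) (Φ (γ s')) < m := by
    have h1 : dist (Φ (γ s)) x₁ ≤ 2 * E.δ := mem_closedBall.1 (hsegball (key hs hnew))
    have h2 : dist (Φ (γ s')) x₁ ≤ 2 * E.δ := mem_closedBall.1 (hsegball (key hs' hnew'))
    linarith [dist_triangle_right (Φ (γ s)) (Φ (γ s')) x₁]
  have hsR : ∀ {r : ℝ≥0}, r ∈ Icc Tn (Tn + Δ) → ‖γ r‖ ≤ R := fun {r} hr ↦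
    hbound r (hr.2.trans (add_le_add hTn le_rfl))
  have := hAI (γ s) (γ s') (hgen.im_nonneg s) (hsR hs) (hgen.im_nonneg s') (hsR hs') hds
  linarith

end CapacityClock

open CapacityClock in
/-- **One exploration step adds at most `Δ` of capacity time before the horizon** (registered
glue form of `CapacityClock.exists_capTime_succ`). [cite: KemppainenSmirnov2017, §3.5] -/
theorem capClock_exists_capTime_succ : ∀ {E : DiscreteDobrushin} {ω : Percolation.BondConfig (Site 2)} {D' : DobrushinDomain} {φ' : ConformalEquiv upperHalfPlaneSet D'.carrier} {W : ℝ≥0 → ℝ}, D'.IsChordalUniformizing φ' → IsLoewnerDescribed φ' (CurveClass.mk ⟨polyline ((medialExploration E ω).map (medialPoint E.δ))⟩) W → IsMedialExploration E ω (medialExploration E ω) → 0 ≤ E.δ → ∀ {R ρ m ρ₁ : ℝ} {L Δ : ℝ≥0}, (∀ u ≤ L + Δ, ‖Loewner.trace W u‖ ≤ R) → (∀ T ≤ L, ∃ s ∈ Icc T (T + Δ), ∃ s' ∈ Icc T (T + Δ), Loewner.trace W s ∉ Loewner.trace W '' Icc 0 T ∧ Loewner.trace W s' ∉ Loewner.trace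 W '' Icc 0 T ∧ ρ ≤ dist (Loewner.trace W s) (Loewner.trace W s')) → (∀ z w : ℂ, 0 ≤ z.im → ‖z‖ ≤ R → 0 ≤ w.im → ‖w‖ ≤ R → dist (φ'.boundaryExtension z) (φ'.boundaryExtension w) < m → dist z w < ρ) → (∀ z : ℂ, 0 ≤ z.im → ‖z‖ ≤ R → ρ₁ ≤ dist (φ'.boundaryExtension z) (D'.pt 1)) → 4 * E.δ < m → 2 * E.δ < ρ₁ → ∀ {n : ℕ} {Tn : ℝ≥0}, Tn ≤ L → φ'.boundaryExtension '' (Loewner.trace W '' Icc 0 Tn) = range (polyline ((explorationPrefix E n ω).map (medialPoint E.δ))) → ∃ T' : ℝ≥0, φ'.boundaryExtension '' (Loewner.trace W '' Icc 0 T') = range (polyline ((explorationPrefix E (n + 1) ω).map (medialPoint E.δ))) ∧ T' ≤ Tn + Δ :=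
  fun hφ' hdesc hexp hδ _ _ _ _ _ _ hbound hNS hAI hproper hδm hδρ _ _ hTn hcap ↦
    exists_capTime_succ hφ' hdesc hexp hδ hbound hNS hAI hproper hδm hδρ hTn hcap

end Summit.CriticalPhenomena.CardyFormulaZ2.Cruxes.CardyRigidity.CrossingMartingale

end
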